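import Summits.QuantumFields.QCD.Theorems.QuarksAsStableActionStableActionBridgeSmitTransferForm
import Summits.QuantumFields.QCD.Theorems.QuarksAsStableActionStableActionBridgeFlavourBlocks
import Literature.MathematicalPhysics.QuantumFieldTheory.QCDPhaseQuenched

/-!
# The `N_f`-flavour Wilson–Dirac determinant in Smit's transfer vocabulary
(crux `QuarksAsStableAction.StableActionBridge`, item stmt-QuantumFields-9737, line `Sketch`;
registered stub `det_diracMatrix_eq_smit_transfer_form`, the `N_f`-flavour version of capstone A)

For an `SU(3)` gauge field `U` on the four-torus `(ℤ/L)⁴` (`L ≥ 1`) and `N_f` flavours of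
`r = 1` Wilson quarks of bare masses `m_f > −1`, the determinant of the STATEMENT's
flavour-diagonal Wilson–Dirac matrix `D(U) = diracMatrix U mq` takes Lüscher's transfer-matrix
form in Smit's slice vocabulary,

  `det D(U) = ∏_t det A(U_t)² · det (1 − ∏_{t=0}^{L−1} M_F(U_t) G_t)`,

with `U_t : (x⃗, j) ↦ U((t, x⃗), j+1)` the slice configuration, `A(U_t) = sliceMassHop U_t mq`
the (flavour-diagonal) spin-blind mass-plus-hop matrix, `M_F(U_t) = fermionSliceMatrix U_t mq` the
one-particle matrix of the fermionic transfer operator `T̂_F(U_t)` (Smit (6.91)) and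
`G_t = sliceGaugeRot (y ↦ U((t, y), 0))` the one-particle gauge rotation by the temporal links.

Assembly: `det D(U) = ∏_f det D_W[U; m_f]` (`det_diracMatrix`, the flavour blocks of
Montvay–Münster §5.1); each one-flavour determinant is capstone A
(`wilson_det_eq_smit_transfer_form`); the product over flavours of the one-flavour
`det (1 − ∏_t M_F G_t)` is the `N_f`-flavour one (`det_one_sub_transfer_prod_eq_prod_flavour`),
and `∏_f det A(U_t)[m_f] = det A(U_t)[mq]` because `A(U_t)` is flavour-block-diagonal
(`FlavourBlocks.sliceMassHop_flavour`, `FlavourBlocks.det_flavour`).  Pure theorem file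
(no definitions).

References: M. Lüscher, Commun. Math. Phys. 54 (1977) 283 [Luscher1977, pp. 283–292]; J. Smit,
*Introduction to Quantum Fields on a Lattice*, §6.5 (6.87)–(6.91)
[Smit2023, §6.5 (6.87)–(6.91)]; I. Montvay and G. Münster, *Quantum Fields on a Lattice*, §5.1
[MontvayMunster1994, §5.1].
-/

noncomputable section

namespace Summit.QuantumFields.QCD.Cruxes.StableActionBridge.Sketch

open MeasureTheory Matrix Literature.MathematicalPhysics.QuantumFieldTheory
  Literature.MathematicalPhysics.QuantumLattice
open Literature.Probability.LatticeModels (TorusSite)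

namespace DiracMatrixTransferForm

/-- **`det A(V)[mq] = ∏_f det A(V)[m_f]`**: the spin-blind mass-plus-hop matrix
`A = diag(m_f + 4) − ½Σ_j(W_j + W_jᴴ)` of a slice configuration `V` is flavour-block-diagonal,
its `f`-block being the one-flavour matrix of mass `m_f` (`FlavourBlocks.sliceMassHop_flavour`),
so its determinant is the product of the one-flavour determinants (`FlavourBlocks.det_flavour`).
[cite: Smit2023, §6.5 (6.74) and (6.85)–(6.86)] -/
theorem det_sliceMassHop_eq_prod_flavour {Nf S : ℕ} [NeZero S]
    (V : GaugeConfig 3 S (Matrix.specialUnitaryGroup (Fin 3) ℂ)) (mq : Fin Nf → ℝ) :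
    (sliceMassHop V mq).det = ∏ f : Fin Nf, (sliceMassHop V (fun _ : Fin 1 => mq f)).det :=
  FlavourBlocks.det_flavour (FlavourBlocks.sliceMassHop_flavour V mq)

/-- **Flavour by flavour**: `det D(U) = ∏_f det D_W[U; m_f]` (`det_diracMatrix`) with each
one-flavour Wilson determinant in Smit's transfer form (capstone A,
`wilson_det_eq_smit_transfer_form`).
[cite: MontvayMunster1994, §5.1] [cite: Smit2023, §6.5 (6.87)–(6.91)] -/
theorem det_diracMatrix_eq_prod_flavour_transfer_form (Nf L : ℕ) [NeZero L]
    (U : GaugeConfig 4 L (Matrix.specialUnitaryGroup (Fin 3) ℂ)) (mq : Fin Nf → ℝ)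
    (hm : ∀ f, -1 < mq f) :
    (diracMatrix U mq).det =
      ∏ f : Fin Nf,
        ((∏ t : ZMod L,
            (sliceMassHop (fun e : Edge 3 L => U ((Fin.cons t e.1 : TorusSite 4 L), e.2.succ))
                (fun _ : Fin 1 => mq f)).det ^ 2) *
          (1 - ((List.range L).map fun i : ℕ =>
              fermionSliceMatrix
                  (fun e : Edge 3 L => U ((Fin.cons (i : ZMod L) e.1 : TorusSite 4 L), e.2.succ))
                  (fun _ : Fin 1 => mq f) *
                sliceGaugeRot (Nf := 1)
                  (fun y : TorusSite 3 L =>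
                    U ((Fin.cons (i : ZMod L) y : TorusSite 4 L), 0))).prod).det) := by
  rw [det_diracMatrix]
  exact Finset.prod_congr rfl fun f _ => wilson_det_eq_smit_transfer_form L U (mq f) (hm f)

end DiracMatrixTransferForm

/-- **Stub `det_diracMatrix_eq_smit_transfer_form` of line `Sketch` (the `N_f`-flavour
capstone A).**
For an `SU(3)` gauge field `U` on the four-torus `(ℤ/L)⁴` and `N_f` flavours of `r = 1` Wilson
quarks of bare masses `m_f > −1`, the determinant of the flavour-diagonal Wilson–Dirac matrix
`D(U) = diracMatrix U mq` is `∏_t det A(U_t)² · det (1 − ∏_{t=0}^{L−1} M_F(U_t) G_t)` with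
`A(U_t) = sliceMassHop U_t mq`, `M_F(U_t) = fermionSliceMatrix U_t mq` and
`G_t = sliceGaugeRot (y ↦ U((t, y), 0))`: flavour by flavour this is capstone A, and both factors
factorise over flavours (`A(U_t)` and `1 − ∏_t M_F G_t` are flavour-block-diagonal).
[cite: Luscher1977, pp. 283–292] [cite: Smit2023, §6.5 (6.87)–(6.91)]
[cite: MontvayMunster1994, §5.1] -/
theorem det_diracMatrix_eq_smit_transfer_form : ∀ (Nf L : ℕ) [NeZero L] (U : GaugeConfig 4 L (Matrix.specialUnitaryGroup (Fin 3) ℂ)) (mq : Fin Nf → ℝ), (∀ f, -1 < mq f) → (diracMatrix U mq).det = (∏ t : ZMod L, (sliceMassHop (fun e : Edge 3 L => U ((Fin.cons t e.1 : TorusSite 4 L), e.2.succ)) mq).det ^ 2) * (1 - ((List.range L).map fun i : ℕ => fermionSliceMatrix (fun e : Edge 3 L => U ((Fin.cons (i : ZMod L) e.1 : TorusSite 4 L), e.2.succ)) mq * sliceGaugeRot (Nf := Nf) (fun y : TorusSite 3 L => U ((Fin.cons (i : ZMod L) y : TorusSite 4 L), 0))).prod).det := by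
  intro Nf L _ U mq hm
  rw [DiracMatrixTransferForm.det_diracMatrix_eq_prod_flavour_transfer_form Nf L U mq hm,
    Finset.prod_mul_distrib, det_one_sub_transfer_prod_eq_prod_flavour Nf L U mq hm]
  congr 1
  rw [Finset.prod_comm]
  refine Finset.prod_congr rfl fun t _ => ?_
  rw [DiracMatrixTransferForm.det_sliceMassHop_eq_prod_flavour, Finset.prod_pow]

end Summit.QuantumFields.QCD.Cruxes.StableActionBridge.Sketch

end
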